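import Mathlib
import Summits.ValiantsHypothesis.ValiantsHypothesis.Theorems.NNDivisionHard.Negative.DiagTiltedLawFalse

/-!
# The vertex-row certificate of KILL NOTE N22 — slots, factors, nonnegativity (crux `FifoMatching.NNDivisionHard`,
# stmt-ValiantsHypothesis-21181; Negative lane)
val-idea-crit-9 g2 (critic of record, WAVE 6).  Second file of the kernel of N22 (`CliqueRowBlind.LocatedPencilLaw` =
`entryTilted.Law` is false on the permutahedron passenger `Q^Π_λ`).  For a located `{0,1}`-tilted row `(a, c)`
(functional `udRow a + flat (diag (𝟙_c − 𝟙_a))`) and a column `(b, π)` the augmented slack is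
`S = (1 − |a∩b|)² + |(a∖c)∩b| + |(c∖a)∖b| + λ·inv(c; π)`.  This file types the SLOT SET `Slot n`
(`|Slot n| = n² + 2(n+1)n² + (n+1)²(8n² + 10n + 2)`), the row factors `rowU a c ≥ 0` and the column factors
`colV b π ≥ 0` of the nonnegative factorization `S = Σ_s rowU·colV` (the identity is the sibling file `…VertexSum`):
the column GUESSES `P = {i : rk π i < |c|}` for `c`; the inversion excess `λ·inv − λ|P∖c|` splits into pair slots
(`E1`, `E2`); the remainder `(1 − y)² + τ + (λ/2)|c Δ P|` (`y = |a∩c∩b|`, `τ = |(c∖a)∖b|`) is factored block by block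
(`k = |c|`, `k' = |a∩c|`) in the two regimes of `D_P = |b∩P| − (1 + k − k')`: `y(y−1) + |D_P| + …` (`D_P < 0`) and
`(Z − δ⁻)² + τ + …` (`D_P ≥ 0`), the budget `(λ/2)|cΔP|` (`λ = 16n`) paying for every correction term in `δ^± = |b∩(cΔP)∩…|`.
Exact rational machine check of the whole certificate at `n = 3, 4` (3 072 / 98 304 cells, 0 mismatches) preceded the typing.
Theorems and concrete data only; VP ≠ VNP is NOT proved; the crux stays OPEN.
-/

namespace Summit.ValiantsHypothesis.Theorems.NNDivisionHardNegative.LocatedPencil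

open Matrix Finset
open Summit.ValiantsHypothesis.ValiantsHypothesis.Theorems.FifoMatching.XcDivision (udInd udInd_apply)
open Summit.ValiantsHypothesis.Theorems.NNDivisionHardNegative.DiagTilted (udInd_nonneg' udInd_le_one')

noncomputable section

variable {n : ℕ}

/-! ## §1 Parameters, the column's guess `P`, the regime statistic `D_P` -/

/-- budget per displaced element of `c Δ P`: `8n`. -/
def bud (n : ℕ) : ℝ := 8 * n

/-- passenger scale `λ = 16n = 2 · bud`. -/
def lam (n : ℕ) : ℝ := 16 * n

/-- the column's guess for the located set: `P_k(π) = {i : rk π i < k}`. -/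
def Pset (k : ℕ) (π : Equiv.Perm (Fin n)) : Finset (Fin n) := Finset.univ.filter fun i => (π i : ℕ) < k

/-- `|P_k(π)| ≤ n`. -/
theorem card_Pset_le_n (k : ℕ) (π : Equiv.Perm (Fin n)) : (Pset k π).card ≤ n :=
  (Finset.card_le_univ _).trans (by simp)

/-- the regime statistic `D_P = |b ∩ P| − (1 + k − k')` of block `(k, k')`. -/
def DP (b : Finset (Fin n)) (π : Equiv.Perm (Fin n)) (k k' : ℕ) : ℝ :=
  ∑ i, udInd b i * udInd (Pset k π) i - (1 + k - k')

/-- `D_P ≤ 2n − 1` (crudely: `|b∩P| ≤ n`, `k' ≤ n`). -/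
theorem DP_le (b : Finset (Fin n)) (π : Equiv.Perm (Fin n)) {k k' : ℕ} (hk' : k' ≤ n) :
    DP b π k k' ≤ 2 * n - 1 := by
  unfold DP
  have h1 : ∑ i, udInd b i * udInd (Pset k π) i ≤ ∑ _i : Fin n, (1 : ℝ) :=
    Finset.sum_le_sum fun i _ => by
      have := udInd_le_one' b i; have := udInd_nonneg' b i
      have := udInd_le_one' (Pset k π) i; have := udInd_nonneg' (Pset k π) i
      nlinarith
  simp only [Finset.sum_const, Finset.card_univ, Fintype.card_fin, nsmul_eq_mul, mul_one] at h1
  have hk'R : (k' : ℝ) ≤ n := by exact_mod_cast hk'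
  have hk : (0 : ℝ) ≤ k := Nat.cast_nonneg k
  linarith

/-! ## §2 The index of the `Z`-sum, the factors `ρ`, `κ`, `β` -/

/-- index of the summands of `Z = D_P + δ⁺ + τ`: `none` ↦ `D_P`, `inl i` ↦ `δ⁺_i`, `inr j` ↦ `τ_j`. -/
abbrev Rix (n : ℕ) := Option (Fin n ⊕ Fin n)

/-- row factor of the `Z`-summand: `1`, `𝟙_c(i)`, `𝟙_{c∖a}(j)`. -/
def rho (a c : Finset (Fin n)) : Rix n → ℝ
  | none => 1
  | some (Sum.inl i) => udInd c i
  | some (Sum.inr j) => udInd c j * (1 - udInd a j)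

/-- column factor of the `Z`-summand: `D_P`, `b_i(1 − P_i)`, `1 − b_j`. -/
def kap (b : Finset (Fin n)) (π : Equiv.Perm (Fin n)) (k k' : ℕ) : Rix n → ℝ
  | none => DP b π k k'
  | some (Sum.inl i) => udInd b i * (1 - udInd (Pset k π) i)
  | some (Sum.inr j) => 1 - udInd b j

/-- budget price of the `Z`-summand in the correction `−2Zδ⁻`: `4n`, `2`, `2`. -/
def beta (n : ℕ) : Rix n → ℝ
  | none => 4 * n
  | some _ => 2

/-! ## §3 Slots and factors -/

/-- index of the block families (block `(k, k')`): `RmD, RmY, RmP, RmC` (regime `D_P < 0`),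
`Zsq, Dneg, Dm2, Tau, Left, Cbud` (regime `D_P ≥ 0`). -/
abbrev BlkIx (n : ℕ) :=
  Unit ⊕ (Fin n × Fin n) ⊕ Fin n ⊕ Fin n ⊕ (Rix n × Rix n) ⊕ (Rix n × Fin n) ⊕ (Fin n × Fin n) ⊕ Fin n ⊕ Fin n ⊕ Fin n

/-- the slot set: `pairB` pairs, `E1`/`E2` pairs per `k`, and the block families per `(k, k')`. -/
abbrev Slot (n : ℕ) :=
  (Fin n × Fin n) ⊕ (Fin (n + 1) × Fin n × Fin n) ⊕ (Fin (n + 1) × Fin n × Fin n) ⊕ (Fin (n + 1) × Fin (n + 1) × BlkIx n)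

/-- row factors of the block families. -/
def blkU (a c : Finset (Fin n)) (k k' : ℕ) : BlkIx n → ℝ :=
  Sum.elim (fun _ => 1) <| Sum.elim
    (fun p => udInd a p.1 * udInd c p.1 * (udInd a p.2 * udInd c p.2) * (if p.1 = p.2 then 0 else 1)) <| Sum.elim
    (fun i => 1 - udInd c i) <| Sum.elim
    (fun i => udInd c i) <| Sum.elim
    (fun p => rho a c p.1 * rho a c p.2) <| Sum.elim
    (fun p => rho a c p.1 * (1 - udInd c p.2)) <| Sum.elim
    (fun p => (1 - udInd c p.1) * (1 - udInd c p.2)) <| Sum.elim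
    (fun j => udInd c j * (1 - udInd a j)) <| Sum.elim
    (fun i => (bud n - 4 * n - 2 * k - 2 * (k - k')) * (1 - udInd c i))
    (fun i => udInd c i)

/-- column factors of the block families (`P = P_k(π)`, regime by the sign of `D_P`). -/
def blkV (b : Finset (Fin n)) (π : Equiv.Perm (Fin n)) (k k' : ℕ) : BlkIx n → ℝ :=
  Sum.elim (fun _ => if DP b π k k' < 0 then -DP b π k k' else 0) <| Sum.elim
    (fun p => if DP b π k k' < 0 then udInd b p.1 * udInd b p.2 else 0) <| Sum.elim
    (fun i => if DP b π k k' < 0 then udInd (Pset k π) i * (udInd b i + bud n) else 0) <| Sum.elim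
    (fun i => if DP b π k k' < 0 then (1 - udInd (Pset k π) i) * (bud n - udInd b i) else 0) <| Sum.elim
    (fun p => if DP b π k k' < 0 then 0 else kap b π k k' p.1 * kap b π k k' p.2) <| Sum.elim
    (fun p => if DP b π k k' < 0 then 0 else
      udInd (Pset k π) p.2 * (beta n p.1 - 2 * kap b π k k' p.1 * udInd b p.2)) <| Sum.elim
    (fun p => if DP b π k k' < 0 then 0 else
      udInd b p.1 * udInd (Pset k π) p.1 * (udInd b p.2 * udInd (Pset k π) p.2)) <| Sum.elim
    (fun j => if DP b π k k' < 0 then 0 else 1 - udInd b j) <| Sum.elim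
    (fun i => if DP b π k k' < 0 then 0 else udInd (Pset k π) i)
    (fun i => if DP b π k k' < 0 then 0 else bud n * (1 - udInd (Pset k π) i))

/-- block selector: the row `(a, c)` lives in block `(|c|, |a∩c|)`. -/
def sel (a c : Finset (Fin n)) (k k' : ℕ) : ℝ := if k = c.card ∧ k' = (a ∩ c).card then 1 else 0

/-- **row factors** `rowU (a, c)`. -/
def rowU (a c : Finset (Fin n)) : Slot n → ℝ :=
  Sum.elim
    (fun p => udInd a p.1 * (1 - udInd c p.1) *
      ((if p.1 = p.2 then 0 else udInd a p.2 * (1 - udInd c p.2)) + 2 * (udInd a p.2 * udInd c p.2))) <| Sum.elim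
    (fun q => (if (q.1 : ℕ) = c.card then 1 else 0) * (lam n * (udInd c q.2.1 * (1 - udInd c q.2.2)))) <| Sum.elim
    (fun q => (if (q.1 : ℕ) = c.card then 1 else 0) *
      (lam n * ((1 - udInd c q.2.1) * (1 - udInd c q.2.2) * (if q.2.1 = q.2.2 then 0 else 1))))
    (fun q => sel a c q.1 q.2.1 * blkU a c q.1 q.2.1 q.2.2)

/-- **column factors** `colV (b, π)`. -/
def colV (b : Finset (Fin n)) (π : Equiv.Perm (Fin n)) : Slot n → ℝ :=
  Sum.elim (fun p => udInd b p.1 * udInd b p.2) <| Sum.elim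
    (fun q => (if π q.2.2 < π q.2.1 then 1 else 0) - udInd (Pset q.1 π) q.2.2 * (1 - udInd (Pset q.1 π) q.2.1)) <|
    Sum.elim
    (fun q => udInd (Pset q.1 π) q.2.1 * udInd (Pset q.1 π) q.2.2)
    (fun q => blkV b π q.1 q.2.1 q.2.2)

/-! ## §4 Nonnegativity -/

/-- `0 ≤ 1 − 𝟙_s(i)`. -/
theorem one_sub_udInd_nonneg (s : Finset (Fin n)) (i : Fin n) : 0 ≤ 1 - udInd s i :=
  sub_nonneg.mpr (udInd_le_one' s i)

/-- `ρ ≥ 0`. -/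
theorem rho_nonneg (a c : Finset (Fin n)) (r : Rix n) : 0 ≤ rho a c r := by
  rcases r with _ | i | j
  · exact zero_le_one
  · exact udInd_nonneg' c i
  · exact mul_nonneg (udInd_nonneg' c j) (one_sub_udInd_nonneg a j)

/-- `κ ≥ 0` in the regime `D_P ≥ 0`. -/
theorem kap_nonneg (b : Finset (Fin n)) (π : Equiv.Perm (Fin n)) (k k' : ℕ) (hD : 0 ≤ DP b π k k') (r : Rix n) :
    0 ≤ kap b π k k' r := by
  rcases r with _ | i | j
  · exact hD
  · exact mul_nonneg (udInd_nonneg' b i) (one_sub_udInd_nonneg _ i)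
  · exact one_sub_udInd_nonneg b j

/-- `2 κ_r · b_i ≤ β_r` (so the corrected column factor `β_r − 2κ_r b_i` is nonnegative). -/
theorem two_kap_mul_le_beta (b : Finset (Fin n)) (π : Equiv.Perm (Fin n)) {k k' : ℕ} (hk' : k' ≤ n) (r : Rix n)
    (i : Fin n) : 2 * kap b π k k' r * udInd b i ≤ beta n r := by
  have hb0 := udInd_nonneg' b i; have hb1 := udInd_le_one' b i
  rcases r with _ | i' | j
  · show 2 * DP b π k k' * udInd b i ≤ 4 * n
    have := DP_le b π (k := k) hk'
    rcases le_or_gt 0 (DP b π k k') with h | h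
    · nlinarith
    · nlinarith
  · show 2 * (udInd b i' * (1 - udInd (Pset k π) i')) * udInd b i ≤ 2
    have := udInd_nonneg' b i'; have := udInd_le_one' b i'
    have := udInd_nonneg' (Pset k π) i'; have := udInd_le_one' (Pset k π) i'
    have h1 : udInd b i' * (1 - udInd (Pset k π) i') ≤ 1 := by nlinarith
    have h0 : 0 ≤ udInd b i' * (1 - udInd (Pset k π) i') := by nlinarith
    nlinarith
  · show 2 * (1 - udInd b j) * udInd b i ≤ 2
    have := udInd_nonneg' b j; have := udInd_le_one' b j
    nlinarith

/-- **`rowU ≥ 0`.** -/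
theorem rowU_nonneg (a c : Finset (Fin n)) (s : Slot n) : 0 ≤ rowU a c s := by
  have h0 := fun (s : Finset (Fin n)) (i : Fin n) => udInd_nonneg' s i
  have h1 := fun (s : Finset (Fin n)) (i : Fin n) => one_sub_udInd_nonneg s i
  have hsel : ∀ k k' : ℕ, 0 ≤ sel a c k k' := fun k k' => by unfold sel; split_ifs <;> norm_num
  have hlam : 0 ≤ lam n := by unfold lam; positivity
  rcases s with ⟨i, m⟩ | ⟨k, l, l'⟩ | ⟨k, l', l''⟩ | ⟨k, k', x⟩
  · refine mul_nonneg (mul_nonneg (h0 a i) (h1 c i)) (add_nonneg ?_ ?_)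
    · split_ifs
      · exact le_rfl
      · exact mul_nonneg (h0 a m) (h1 c m)
    · exact mul_nonneg zero_le_two (mul_nonneg (h0 a m) (h0 c m))
  · exact mul_nonneg (by split_ifs <;> norm_num) (mul_nonneg hlam (mul_nonneg (h0 c l) (h1 c l')))
  · refine mul_nonneg (by split_ifs <;> norm_num) (mul_nonneg hlam (mul_nonneg (mul_nonneg (h1 c l') (h1 c l'')) ?_))
    split_ifs <;> norm_num
  · refine mul_nonneg (hsel k k') ?_
    have hkn : ((k : ℕ) : ℝ) ≤ n := by exact_mod_cast Nat.lt_succ_iff.mp k.isLt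
    have hk'0 : (0 : ℝ) ≤ ((k' : ℕ) : ℝ) := Nat.cast_nonneg _
    show 0 ≤ blkU a c k k' x
    rcases x with _ | ⟨i, m⟩ | i | i | ⟨r, r'⟩ | ⟨r, i⟩ | ⟨i, i'⟩ | j | i | i
    · exact zero_le_one
    · exact mul_nonneg (mul_nonneg (mul_nonneg (h0 a i) (h0 c i)) (mul_nonneg (h0 a m) (h0 c m)))
        (by split_ifs <;> norm_num)
    · exact h1 c i
    · exact h0 c i
    · exact mul_nonneg (rho_nonneg a c r) (rho_nonneg a c r')
    · exact mul_nonneg (rho_nonneg a c r) (h1 c i)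
    · exact mul_nonneg (h1 c i) (h1 c i')
    · exact mul_nonneg (h0 c j) (h1 a j)
    · refine mul_nonneg ?_ (h1 c i)
      show (0 : ℝ) ≤ bud n - 4 * n - 2 * ((k : ℕ) : ℝ) - 2 * (((k : ℕ) : ℝ) - ((k' : ℕ) : ℝ))
      unfold bud; linarith
    · exact h0 c i

/-- the `E1` column factor is nonnegative: `P_{l'}(1 − P_l) = 1` forces `rk π l' < k ≤ rk π l`. -/
theorem e1_nonneg (π : Equiv.Perm (Fin n)) (k : ℕ) (l l' : Fin n) :
    0 ≤ (if π l' < π l then (1 : ℝ) else 0) - udInd (Pset k π) l' * (1 - udInd (Pset k π) l) := by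
  rw [udInd_apply, udInd_apply]
  by_cases h' : l' ∈ Pset k π
  · by_cases h : l ∈ Pset k π
    · rw [if_pos h', if_pos h]; split_ifs <;> norm_num
    · have hlt : π l' < π l := by
        simp only [Pset, Finset.mem_filter, Finset.mem_univ, true_and, not_lt] at h h'
        exact Fin.lt_def.mpr (lt_of_lt_of_le h' h)
      rw [if_pos hlt, if_pos h', if_neg h]; norm_num
  · rw [if_neg h']; split_ifs <;> norm_num

/-- the block column factors are nonnegative. -/
theorem blkV_nonneg (hn : 1 ≤ n) (b : Finset (Fin n)) (π : Equiv.Perm (Fin n)) (k : ℕ) {k' : ℕ} (hk' : k' ≤ n)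
    (x : BlkIx n) : 0 ≤ blkV b π k k' x := by
  have h0 := fun (s : Finset (Fin n)) (i : Fin n) => udInd_nonneg' s i
  have h1 := fun (s : Finset (Fin n)) (i : Fin n) => one_sub_udInd_nonneg s i
  have hbud : ∀ i, 0 ≤ bud n - udInd b i := fun i => by
    have := udInd_le_one' b i
    have : (1 : ℝ) ≤ n := by exact_mod_cast hn
    unfold bud; linarith
  have hbud0 : 0 ≤ bud n := by unfold bud; positivity
  unfold blkV
  rcases x with _ | ⟨i, m⟩ | i | i | ⟨r, r'⟩ | ⟨r, i⟩ | ⟨i, i'⟩ | j | i | i <;>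
    simp only [Sum.elim_inl, Sum.elim_inr] <;> split_ifs with hD
  · linarith
  · exact le_rfl
  · exact mul_nonneg (h0 b i) (h0 b m)
  · exact le_rfl
  · exact mul_nonneg (h0 _ i) (add_nonneg (h0 b i) hbud0)
  · exact le_rfl
  · exact mul_nonneg (h1 _ i) (hbud i)
  · exact le_rfl
  · exact le_rfl
  · exact mul_nonneg (kap_nonneg b π k k' (not_lt.mp hD) r) (kap_nonneg b π k k' (not_lt.mp hD) r')
  · exact le_rfl
  · exact mul_nonneg (h0 _ i) (by linarith [two_kap_mul_le_beta b π (k := k) hk' r i])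
  · exact le_rfl
  · exact mul_nonneg (mul_nonneg (h0 b i) (h0 _ i)) (mul_nonneg (h0 b i') (h0 _ i'))
  · exact le_rfl
  · exact h1 b j
  · exact le_rfl
  · exact h0 _ i
  · exact le_rfl
  · exact mul_nonneg hbud0 (h1 _ i)

/-- **`colV ≥ 0`** (`n ≥ 1` makes the budget `8n ≥ 1 ≥ b_i`). -/
theorem colV_nonneg (hn : 1 ≤ n) (b : Finset (Fin n)) (π : Equiv.Perm (Fin n)) (s : Slot n) : 0 ≤ colV b π s := by
  rcases s with ⟨i, m⟩ | ⟨k, l, l'⟩ | ⟨k, l', l''⟩ | ⟨k, k', x⟩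
  · exact mul_nonneg (udInd_nonneg' b i) (udInd_nonneg' b m)
  · exact e1_nonneg π k l l'
  · exact mul_nonneg (udInd_nonneg' _ l') (udInd_nonneg' _ l'')
  · exact blkV_nonneg hn b π k (Nat.lt_succ_iff.mp k'.isLt) x

end

end Summit.ValiantsHypothesis.Theorems.NNDivisionHardNegative.LocatedPencil
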